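import Mathlib
import Summits.Ventures.HodgeRepro.Tier4.Common.AdelicDefs
import Summits.Ventures.HodgeRepro.Tier4.Common.CongruenceAdeles
import Summits.Ventures.HodgeRepro.Tier4.Common.CompactOpenLevel
import Summits.Ventures.HodgeRepro.Tier4.Common.RowWeights
import Summits.Ventures.HodgeRepro.Tier4.Line1.AdelicParts
import Summits.Ventures.HodgeRepro.Tier4.Line1.FiniteLevelIsolation
import Summits.Ventures.HodgeRepro.Tier4.Line4.LevelCosetCongruence
import Summits.Ventures.HodgeRepro.Tier4.Line4.IntegerArchBound
import Summits.Ventures.HodgeRepro.Tier4.Line4.L1ClassV3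
import Summits.Ventures.HodgeRepro.Tier4.Line4.ArchDistBounds
import Summits.Ventures.HodgeRepro.Tier4.Line4.ArchDistLower
import Summits.Ventures.HodgeRepro.Tier4.Line4.BlockDetCongruence
import Summits.Ventures.HodgeRepro.Tier4.Line4.FinitePartCongruence
import Summits.Ventures.HodgeRepro.Tier4.Line4.OrbitInvariant
import Summits.Ventures.HodgeRepro.Tier4.Line4.OrbitInvariantFinite

/-!
# Tier4/Line4/OrbitInvariantDenominator — SparsityOffFibre WITHOUT the integrality clause on `γ₀`: bounded denominators

Blind re-derivation cell `pub-hodge-repro`, Tier 4 «prove the step» (README §9–§10), seat t4-L1-p3 (gen 4).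
Tree path `lean/Summits/Ventures/HodgeRepro/Tier4/Line4/OrbitInvariantDenominator.lean`.

crit-2 Entry 271 (S15367): the `hR` binder of record (OrbitInvariantFinite v2) takes `hint : IsIntegralFin W γ₀`, while
the planners want the `γ₀` existence theorem free of integrality clauses (the level prime is chosen after `γ₀`).  This
module removes the clause: for a `γ₀` whose matrix has a finite-integral multiple `(D : ℕ) • GA.mat W γ₀` (every
rational point has one — IntegralTransport's `exists_integer_smul_integral` for the `k`-matrix; `D` = the
denominator), the level congruence holds up to `D`: `D • (mat (κ γ₀ κ') − mat γ₀) ≡ 0 (mod N)` entrywise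
(`smul_mat_sub_mem_congrSet_of_mem_levelK`), the invariant (quadratic in the entries) satisfies
`D² • (orbitInv (κ γ₀ κ') − orbitInv γ₀) ≡ 0 (mod N)` (`smul_orbitInv_sub_mem_congrSet_of_mem_levelK`) and on finite
parts (`smul_finPart_orbitInv_sub_mem_modSet_of_ofFinPart_eq`), the rational form `D² (c − orbitInvK g m₀) = N z`
(`exists_eq_N_mul_of_orbitInv_eq_algebraMap_smul`), and the OFF-FIBRE read-out with `N / D²` in place of `N`:
**`log (max 1 (N / D² − B)) ≤ 2 · archDist W y + log (2 G²)`** (`log_max_one_le_two_mul_archDist_add_of_orbitInv_ne_smul`)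
— x2's `hR` with `g N := (log (max 1 (N / D² − B)) − log (2 G²)) / 2`, still `→ ∞`.  `D = 1` recovers v2.
No printed input.  HC_CM is NOT proved by anyone in this repository.
-/

namespace Summit.Ventures.HodgeRepro.Tier4.Line4

open Summit.Ventures.HodgeRepro.Tier4.Common Summit.Ventures.HodgeRepro.Tier4.Line1 NumberField Matrix
open scoped NumberField

noncomputable section

section Congruence

variable {k : Type} [Field k] [NumberField k] (W : PlaneData k)

/-- `D • (κ g κ' − g) ≡ 0 (mod N)` entrywise when `D • mat g` is finite-integral and `κ, κ' ∈ K(N)`. -/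
theorem smul_mat_sub_mem_congrSet_of_mem_levelK {N : ℕ} {κ κ' g : GA W} (hκ : κ ∈ levelK W N)
    (hκ' : κ' ∈ levelK W N) {D : ℕ} (hD : IsIntegralFinMat ((D : Ad k) • GA.mat W g)) (i j : Fin 4) :
    ((D : Ad k) • (GA.mat W (κ * g * κ') - GA.mat W g)) i j ∈ congrSet k N := by
  have hA₁ : IsCongr k N (GA.mat W κ) := ((mem_levelK W N κ).mp hκ).1
  have hA : IsCongr k N (GA.mat W κ') := ((mem_levelK W N κ').mp hκ').1
  have hmat : GA.mat W (κ * g * κ') = GA.mat W κ * GA.mat W g * GA.mat W κ' := by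
    simp [GA.mat, Subgroup.coe_mul, Units.val_mul]
  set A := (D : Ad k) • GA.mat W g with hAdef
  have hsplit : (D : Ad k) • (GA.mat W (κ * g * κ') - GA.mat W g) =
      (GA.mat W κ * A * GA.mat W κ' - A * GA.mat W κ') + (A * GA.mat W κ' - A) := by
    rw [hmat, hAdef, sub_add_sub_cancel, smul_sub]
    congr 1
    rw [Matrix.mul_smul, Matrix.smul_mul]
  rw [hsplit, Matrix.add_apply]
  refine (congrSet k N).add_mem ?_ ?_
  · have hAk : IsIntegralFinMat (A * GA.mat W κ') := hD.mul (IsIntegralFinMat.of_isCongr hA)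
    have := mat_mul_sub_mem_congrSet hA₁ hAk i j
    rwa [← Matrix.mul_assoc] at this
  · exact mat_sub_mul_mem_congrSet hA hD i j

/-- The four-term identity for the block determinant of a perturbation. -/
theorem blockDet_add_sub_eq (M Δ : M4 k) (i₀ i₁ j₀ j₁ : Fin 4) :
    blockDet (M + Δ) i₀ i₁ j₀ j₁ - blockDet M i₀ i₁ j₀ j₁ =
      (Δ i₀ j₀ * M i₁ j₁ + M i₀ j₀ * Δ i₁ j₁ + Δ i₀ j₀ * Δ i₁ j₁) -
        (Δ i₀ j₁ * M i₁ j₀ + M i₀ j₁ * Δ i₁ j₀ + Δ i₀ j₁ * Δ i₁ j₀) := by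
  simp only [blockDet, Matrix.add_apply]
  ring

/-- **`D² • (orbitInv (κ g κ') − orbitInv g) ≡ 0 (mod N)`** for `κ, κ' ∈ K(N)`, `D • mat g` finite-integral and the
transport `g₀` finite-integral. -/
theorem smul_orbitInv_sub_mem_congrSet_of_mem_levelK (g₀ : Matrix (Fin 4) (Fin 4) k)
    (hg₀ : IsIntegralFinMat (adMat k g₀)) {N : ℕ} {κ κ' g : GA W} (hκ : κ ∈ levelK W N) (hκ' : κ' ∈ levelK W N)
    {D : ℕ} (hD : IsIntegralFinMat ((D : Ad k) • GA.mat W g)) :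
    ((D : Ad k) ^ 2) * (orbitInv W g₀ (κ * g * κ') - orbitInv W g₀ g) ∈ congrSet k N := by
  rw [orbitInv_eq_blockDet, orbitInv_eq_blockDet]
  -- `mat (κ g κ') g₀ = mat g g₀ + Δ g₀` with `Δ = mat (κ g κ') − mat g`
  set Δ := GA.mat W (κ * g * κ') - GA.mat W g with hΔ
  have hM : GA.mat W (κ * g * κ') * adMat k g₀ = GA.mat W g * adMat k g₀ + Δ * adMat k g₀ := by
    rw [hΔ, Matrix.sub_mul, add_sub_cancel]
  rw [hM, blockDet_add_sub_eq]
  -- the integral factor `D • mat g g₀` and the congruence factor `D • Δ g₀`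
  have hDM : IsIntegralFinMat ((D : Ad k) • (GA.mat W g * adMat k g₀)) := by
    rw [← Matrix.smul_mul]
    exact hD.mul hg₀
  have hDΔ : ∀ i j, ((D : Ad k) • (Δ * adMat k g₀)) i j ∈ congrSet k N := by
    intro i j
    rw [← Matrix.smul_mul, Matrix.mul_apply]
    refine sum_mem_congrSet k _ fun l _ => ?_
    exact mul_mem_congrSet_of_integral k (smul_mat_sub_mem_congrSet_of_mem_levelK W hκ hκ' hD i l) (hg₀ l j)
  -- distribute `D²` over the four-term identity
  have key : ∀ (a b : Ad k), (D : Ad k) ^ 2 * (a * b) = ((D : Ad k) * a) * ((D : Ad k) * b) := by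
    intro a b; ring
  have hsm : ∀ (X : M4 k) (i j : Fin 4), ((D : Ad k) • X) i j = (D : Ad k) * X i j := fun X i j => rfl
  simp only [mul_sub, mul_add, key]
  simp only [← hsm]
  refine (congrSet k N).sub_mem ((congrSet k N).add_mem ((congrSet k N).add_mem ?_ ?_) ?_)
    ((congrSet k N).add_mem ((congrSet k N).add_mem ?_ ?_) ?_)
  · exact mul_mem_congrSet_of_integral k (hDΔ 0 0) (hDM 1 1)
  · exact mul_mem_congrSet_of_integral' k (hDM 0 0) (hDΔ 1 1)
  · exact congrSet_mul_mem k (hDΔ 0 0) (hDΔ 1 1)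
  · exact mul_mem_congrSet_of_integral k (hDΔ 0 1) (hDM 1 0)
  · exact mul_mem_congrSet_of_integral' k (hDM 0 1) (hDΔ 1 0)
  · exact congrSet_mul_mem k (hDΔ 0 1) (hDΔ 1 0)

end Congruence

section Finite

variable {k : Type} [Field k] [NumberField k] (W : PlaneData k) (g : Matrix (Fin 4) (Fin 4) k)

/-- The congruence on finite parts with a denominator `D`: `D² (finPart (orbitInv x) − finPart (orbitInv γ₀))` lies in
`N · ∏_v 𝓞_v` when the finite part of `x` lies in `K(N) γ₀ K(N)` and `D • mat γ₀` is finite-integral. -/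
theorem smul_finPart_orbitInv_sub_mem_modSet_of_ofFinPart_eq {N : ℕ} (hg : IsIntegralFinMat (adMat k g))
    {κ₁ κ₂ x γ₀ : GA W} (hκ₁ : κ₁ ∈ levelK W N) (hκ₂ : κ₂ ∈ levelK W N) {D : ℕ}
    (hD : IsIntegralFinMat ((D : Ad k) • GA.mat W γ₀))
    (hcos : GA.ofFinPart W x = κ₁ * GA.ofFinPart W γ₀ * κ₂) :
    (finPart k ((D : Ad k) ^ 2)) * (finPart k (orbitInv W g x) - finPart k (orbitInv W g γ₀)) ∈ modSet k N := by
  have hD' : IsIntegralFinMat ((D : Ad k) • GA.mat W (GA.ofFinPart W γ₀)) := by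
    intro i j
    have h := hD i j
    simp only [Matrix.smul_apply, smul_eq_mul, map_mul] at h ⊢
    rw [finPart_mat_ofFinPart_apply]
    exact h
  have hc := (smul_orbitInv_sub_mem_congrSet_of_mem_levelK W g hg hκ₁ hκ₂ hD').2
  rw [map_mul, map_sub, ← hcos, finPart_orbitInv_ofFinPart, finPart_orbitInv_ofFinPart] at hc
  exact hc

/-- The rational form: `D² (c − orbitInvK g m₀)` is `N` times an integer of `k`. -/
theorem exists_eq_N_mul_of_orbitInv_eq_algebraMap_smul {N : ℕ} (hN : N ≠ 0) (hg : IsIntegralFinMat (adMat k g))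
    {κ₁ κ₂ x γ₀ : GA W} (hκ₁ : κ₁ ∈ levelK W N) (hκ₂ : κ₂ ∈ levelK W N) {D : ℕ}
    (hD : IsIntegralFinMat ((D : Ad k) • GA.mat W γ₀))
    (hcos : GA.ofFinPart W x = κ₁ * GA.ofFinPart W γ₀ * κ₂) {c : k}
    (hx : orbitInv W g x = algebraMap k (Ad k) c) {m₀ : Matrix (Fin 4) (Fin 4) k}
    (hm₀ : GA.mat W γ₀ = m₀.map (algebraMap k (Ad k))) :
    ∃ z : 𝓞 k, (D : k) ^ 2 * (c - orbitInvK g m₀) = (N : k) * algebraMap (𝓞 k) k z := by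
  have h := smul_finPart_orbitInv_sub_mem_modSet_of_ofFinPart_eq W g hg hκ₁ hκ₂ hD hcos
  rw [hx, orbitInv_eq_algebraMap W g hm₀] at h
  have heq : finPart k ((D : Ad k) ^ 2) * (finPart k (algebraMap k (Ad k) c) -
      finPart k (algebraMap k (Ad k) (orbitInvK g m₀))) =
      finPart k (algebraMap k (Ad k) ((D : k) ^ 2 * (c - orbitInvK g m₀))) := by
    simp only [map_mul, map_sub, map_pow, map_natCast]
  rw [heq] at h
  exact exists_eq_N_mul_of_finPart_algebraMap_mem_modSet hN h

/-- **THE OFF-FIBRE READ-OUT WITH BOUNDED DENOMINATORS**: as OrbitInvariantFinite v2's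
`log_max_one_le_two_mul_archDist_add_of_orbitInv_ne'`, with `hint` replaced by `D • mat γ₀` finite-integral and `N`
replaced by `N / D²`. -/
theorem log_max_one_le_two_mul_archDist_add_of_orbitInv_ne_smul {N : ℕ} (hN : N ≠ 0)
    (hg : IsIntegralFinMat (adMat k g)) {G : ℝ} (hG1 : 1 ≤ G)
    (hG : ∀ (w : InfinitePlace k) (l j : Fin 4), ‖Common.adToC w (adMat k g l j)‖ ≤ G)
    {κ₁ κ₂ x y γ₀ : GA W} (hκ₁ : κ₁ ∈ levelK W N) (hκ₂ : κ₂ ∈ levelK W N)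
    (hγ₀ : γ₀ ∈ rationalPoints W) {D : ℕ} (hD0 : D ≠ 0) (hD : IsIntegralFinMat ((D : Ad k) • GA.mat W γ₀))
    (hcos : GA.ofFinPart W x = κ₁ * GA.ofFinPart W γ₀ * κ₂) (hxy : orbitInv W g x = orbitInv W g y) {c : k}
    (hy : orbitInv W g y = algebraMap k (Ad k) c) (hne : orbitInv W g y ≠ orbitInv W g γ₀)
    {B : ℝ} (hB : ∀ w : InfinitePlace k, ‖Common.adToC w (orbitInv W g γ₀)‖ ≤ B) :
    Real.log (max 1 ((N : ℝ) / (D : ℝ) ^ 2 - B)) ≤ 2 * L1Class.archDist W y + Real.log (2 * G ^ 2) := by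
  obtain ⟨m₀, hm₀⟩ := exists_rational_mat_of_mem_rationalPoints W hγ₀
  have hx : orbitInv W g x = algebraMap k (Ad k) c := hxy.trans hy
  obtain ⟨z, hz⟩ := exists_eq_N_mul_of_orbitInv_eq_algebraMap_smul W g hN hg hκ₁ hκ₂ hD hcos hx hm₀
  have hDk : (D : k) ≠ 0 := Nat.cast_ne_zero.mpr hD0
  have hz0 : z ≠ 0 := by
    intro h0
    apply hne
    rw [h0, map_zero, mul_zero, mul_eq_zero, sub_eq_zero] at hz
    rcases hz with h | h
    · exact absurd (pow_eq_zero_iff two_ne_zero |>.mp h) hDk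
    · rw [hy, orbitInv_eq_algebraMap W g hm₀, h]
  obtain ⟨w, hw⟩ := exists_infinitePlace_natCast_le_of_sub_eq hz0 (show (D : k) ^ 2 * c - (D : k) ^ 2 * orbitInvK g m₀ =
    (N : k) * algebraMap (𝓞 k) k z by rw [← mul_sub, hz])
  -- `w ((D²) c − (D²) c₀) = D² · w (c − c₀)`
  have hwD : w ((D : k) ^ 2 * c - (D : k) ^ 2 * orbitInvK g m₀) = (D : ℝ) ^ 2 * w (c - orbitInvK g m₀) := by
    rw [← mul_sub, map_mul, map_pow, InfinitePlace.map_natCast]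
  rw [hwD] at hw
  have hD2 : (0 : ℝ) < (D : ℝ) ^ 2 := by positivity
  have hw' : (N : ℝ) / (D : ℝ) ^ 2 ≤ w (c - orbitInvK g m₀) := by
    rw [div_le_iff₀ hD2]
    linarith
  have h1 := L1Class.InfinitePlace.apply_sub_le w c (orbitInvK g m₀)
  have h2 : w (orbitInvK g m₀) = ‖Common.adToC w (orbitInv W g γ₀)‖ := by
    rw [orbitInv_eq_algebraMap W g hm₀, L1Class.norm_adToC_algebraMap]
  have h3 : w c = ‖Common.adToC w (orbitInv W g y)‖ := by
    rw [hy, L1Class.norm_adToC_algebraMap]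
  have hB' := hB w
  refine log_max_one_le_two_mul_archDist_add_of_le_norm_orbitInv W g w hG1 (hG w) y ?_
  linarith

end Finite

/-! ## v2 (append): the seesaw wrapper at the RATIONAL point (crit-2 Entry 278: the one untyped piece of binder set (A)) -/

section Seesaw

variable {k : Type} [Field k] [NumberField k] (q : QuadData k) (a b ε a' b' ε' : k)
  (g g' : Matrix (Fin 4) (Fin 4) k) (hgg' : g * g' = 1) (hg'g : g' * g = 1)
  (hgΩ : g * (PlaneData.ofLinesRow q a b ε).Ω = (PlaneData.ofLinesRow q a b ε).Ω * g)

/-- **SparsityOffFibre AT THE RATIONAL POINT, bounded denominators** (x2's `hR` shape, `d γ := archDist W γ`): for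
rational `γ` with a torus translate `τ γ τ'` whose finite part lies in the level-`N` coset of a rational `γ₀` with
denominator `D`, off the fibre of `γ₀`: `log (max 1 (N / D² − B)) ≤ 2 · archDist W γ + log (2 G²)`. -/
theorem log_max_one_le_two_mul_archDist_add_of_orbitInv_ne_smul_seesaw' (ha : a ≠ 0) (hb : b ≠ 0) (hε : ε ≠ 0)
    (ha' : a' ≠ 0) (hb' : b' ≠ 0) (hε' : ε' ≠ 0) (lam : k)
    (hiso : g * (PlaneData.ofLinesRow q a' b' ε').B * gᵀ = lam • (PlaneData.ofLinesRow q a b ε).B)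
    {N : ℕ} (hN : N ≠ 0) (hg : IsIntegralFinMat (adMat k g)) {G : ℝ} (hG1 : 1 ≤ G)
    (hG : ∀ (w : InfinitePlace k) (l j : Fin 4), ‖Common.adToC w (adMat k g l j)‖ ≤ G)
    {κ₁ κ₂ τ γ τ' γ₀ : GA ((PlaneData.ofLinesRow q a b ε).withTransportedTorus g g' hgg' hg'g hgΩ)}
    (hκ₁ : κ₁ ∈ levelK _ N) (hκ₂ : κ₂ ∈ levelK _ N)
    (hτ : τ ∈ torusT ((PlaneData.ofLinesRow q a b ε).withTransportedTorus g g' hgg' hg'g hgΩ))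
    (hτ' : τ' ∈ torusT' ((PlaneData.ofLinesRow q a b ε).withTransportedTorus g g' hgg' hg'g hgΩ))
    (hγ : γ ∈ rationalPoints _) (hγ₀ : γ₀ ∈ rationalPoints _) {D : ℕ} (hD0 : D ≠ 0)
    (hD : IsIntegralFinMat ((D : Ad k) • GA.mat _ γ₀))
    (hcos : GA.ofFinPart _ (τ * γ * τ') = κ₁ * GA.ofFinPart _ γ₀ * κ₂)
    (hne : orbitInv _ g γ ≠ orbitInv _ g γ₀)
    {B : ℝ} (hB : ∀ w : InfinitePlace k, ‖Common.adToC w (orbitInv _ g γ₀)‖ ≤ B) :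
    Real.log (max 1 ((N : ℝ) / (D : ℝ) ^ 2 - B)) ≤ 2 * L1Class.archDist _ γ + Real.log (2 * G ^ 2) := by
  obtain ⟨m, hm⟩ := exists_rational_mat_of_mem_rationalPoints _ hγ
  have hxy : orbitInv _ g (τ * γ * τ') = orbitInv _ g γ :=
    orbitInv_orbit q a b ε a' b' ε' g g' hgg' hg'g hgΩ ha hb hε ha' hb' hε' lam hiso τ γ τ' hτ hτ'
  exact log_max_one_le_two_mul_archDist_add_of_orbitInv_ne_smul _ g hN hg hG1 hG hκ₁ hκ₂ hγ₀ hD0 hD hcos hxy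
    (orbitInv_eq_algebraMap _ g hm) hne hB

end Seesaw

end

end Summit.Ventures.HodgeRepro.Tier4.Line4
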